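import Summits.RiemannHypothesis.RiemannHypothesis.Theorems.MotivicDoor.AWS.GeneratingFamilyForcing

/-!
# AWS plumbing IV: the prime-side pairing on the coefficient space of a generating family

HONEST LABEL (verbatim on every AWS file).  One-way implication from a strengthened, prime-side-only
axiom system; the existence of such an object is NOT claimed and is the located gap.  AXIOM-CONTENT
(ref-1/ref-2, coordinator gate 2026-08-19T21:51Z) corrects the earlier label: for THIS axiom system
the converse is TAUTOLOGICAL (hence uninformative), not "not expected to be provable" — this file
and its sequel `AWS/CanonicalCarrier` are the kernel form of that honesty audit (the referees'
DERIVED §2 made PROVED), not an attempt at the converse as mathematics.  Framing: lottery ticket at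
the motivic door; RH probability negligible; consolation prizes are real: a new semi-local
Weil-positivity theorem, or a located gap in the Connes–Consani programme, plus the ff-door theorem.

## What is here (all PROVED; REFEREE-1 P3 "the one lemma not yet in the tree": bilinearity)

For a generating family `G` (`Theorems/MotivicDoorAWSStructure`), on the REAL coefficient space
`G.ι →₀ ℝ` (real combinations `rtest a = Σ a_i φ_i` of the generators):

* `G.rtest`, its additivity / homogeneity, `isWeilTest_rtest`, and `rtest_intCoeffs`
  (`testCombination G.φ c` is `rtest` of the integer coefficient vector);
* the two degrees as `ℝ`-LINEAR maps `G.M₀ a = ∫ toMul(rtest a) d*u`, `G.M₁ a = ∫ toMul(rtest a) du`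
  (`weilMellin` at `0`, `1`; `weilMellin_add`, `weilMellin_const_mul`; bridges
  `weilMellin_zero_eq_massDstar`, `weilMellin_one_eq_massDu`);
* Weil's cross functional as an `ℝ`-BILINEAR map `G.Wc a b = Re W(rtest a ⋆ (rtest b)~)`
  (`weilConv_add_left/right`, `weilReflect_add`, `weilFunctional_add`, the `const_mul` lemmas),
  symmetric (`weilFunctional_weilConv_weilReflect_swap_of_real`), with `G.Wc a a = Re Q(rtest a)`;
* the PRIME-SIDE FORM `G.primeForm = M₀ ⊗ M₁ + M₁ ⊗ M₀ − Wc`, a symmetric `ℝ`-bilinear form whose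
  diagonal is `2 𝔰(f, f)` (`primeForm_self`, by `two_mul_ccPairing_sub_two_mul_masses_eq`) — the
  polarisation of `c ↦ 2𝔰(f_c, f_c)` that the structure's field `frob_frob` decrees;
* the CARRIER FORM on `(G.ι →₀ ℝ) × ℝ × ℝ` (AXIOM-CONTENT §2, verbatim):
  `(a,x,y)·(b,x',y') = primeForm a b + x M₀ b + x' M₀ a + y M₁ b + y' M₁ a + x y' + x' y`,
  symmetric, with the rulings `E₁ = (0,1,0)`, `E₂ = (0,0,1)` hyperbolic, and the KEY IDENTITY
  `carrierForm_self_of_perp`: on `⟨E₁, E₂⟩^⊥` the form is `−Re Q(rtest a)`.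

All inputs are prime-side / explicit-formula objects of the tree (`weilFunctional` is DEFINED as
polar − prime + archimedean terms; no zero of `ζ`, no `RiemannHypothesis` anywhere in this file).
-/

noncomputable section

open Complex Literature.NumberTheory.LFunctions Literature.NumberTheory.ConnesConsani2019
open Summit.RiemannHypothesis.RiemannHypothesis.Theorems.MotivicDoor.ConnesConsani
open scoped BigOperators ComplexConjugate

namespace Summit.RiemannHypothesis.RiemannHypothesis.Theorems.MotivicDoor.AWS

namespace GeneratingFamily

variable (G : GeneratingFamily)

/-! ## Real combinations of the generators -/

/-- The real combination `Σ_i a_i φ_i` of the generators. -/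
def rtest (a : G.ι →₀ ℝ) : ℝ → ℝ := fun t ↦ a.sum fun i r ↦ r * G.φ i t

/-- Additivity in the coefficients. -/
theorem rtest_add (a b : G.ι →₀ ℝ) : G.rtest (a + b) = G.rtest a + G.rtest b := by
  funext t
  simp only [rtest, Pi.add_apply]
  rw [Finsupp.sum_add_index' (fun _ ↦ by simp) (fun _ _ _ ↦ by rw [add_mul])]

/-- Homogeneity in the coefficients. -/
theorem rtest_smul (r : ℝ) (a : G.ι →₀ ℝ) : G.rtest (r • a) = r • G.rtest a := by
  funext t
  simp only [rtest, Pi.smul_apply, smul_eq_mul]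
  rw [Finsupp.sum_smul_index' (fun _ ↦ by simp), Finsupp.mul_sum]
  exact Finsupp.sum_congr fun i _ ↦ by rw [smul_eq_mul, mul_assoc]

/-- Complexified additivity. -/
theorem rtest_add_coe (a b : G.ι →₀ ℝ) :
    (fun t ↦ (G.rtest (a + b) t : ℂ)) = (fun t ↦ (G.rtest a t : ℂ)) + fun t ↦ (G.rtest b t : ℂ) := by
  funext t
  simp [rtest_add]

/-- Complexified homogeneity. -/
theorem rtest_smul_coe (r : ℝ) (a : G.ι →₀ ℝ) :
    (fun t ↦ (G.rtest (r • a) t : ℂ)) = fun t ↦ (r : ℂ) * (G.rtest a t : ℂ) := by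
  funext t
  simp [rtest_smul]

/-- The integer coefficient vector of `c`, seen in `G.ι →₀ ℝ`. -/
def intCoeffs (c : G.ι →₀ ℤ) : G.ι →₀ ℝ := c.mapRange (fun n : ℤ ↦ (n : ℝ)) (by simp)

/-- `intCoeffs` is additive. -/
theorem intCoeffs_add (c c' : G.ι →₀ ℤ) : G.intCoeffs (c + c') = G.intCoeffs c + G.intCoeffs c' :=
  Finsupp.mapRange_add (by simp) c c'

/-- `testCombination G.φ c = rtest (intCoeffs c)`: integer combinations are real combinations. -/
theorem rtest_intCoeffs (c : G.ι →₀ ℤ) : G.rtest (G.intCoeffs c) = testCombination G.φ c := by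
  funext t
  simp only [rtest, intCoeffs, testCombination]
  rw [Finsupp.sum_mapRange_index (fun _ ↦ by simp)]

/-- Real combinations of the generators are (real) Weil test functions. -/
theorem isWeilTest_rtest (a : G.ι →₀ ℝ) : IsWeilTest fun t ↦ (G.rtest a t : ℂ) := by
  classical
  have key : ∀ s : Finset G.ι,
      IsWeilTest fun t ↦ ∑ i ∈ s, ((a i : ℝ) : ℂ) * (G.φ i t : ℂ) := by
    intro s
    induction s using Finset.induction_on with
    | empty =>
      simp only [Finset.sum_empty]
      change IsWeilTest (0 : ℝ → ℂ)
      exact ⟨contDiff_const, HasCompactSupport.zero⟩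
    | insert i s hi ih =>
      simpa [Finset.sum_insert hi, Pi.add_def] using
        ((G.isWeilTest i).const_mul ((a i : ℝ) : ℂ)).add ih
  convert key a.support using 2 with t
  simp [rtest, Finsupp.sum, Complex.ofReal_sum, Complex.ofReal_mul]

/-! ## The two degrees as linear maps -/

/-- `M₀ a = Re (rtest a)^(0) = ∫ toMul (rtest a) d*u` as an `ℝ`-linear map. -/
def M₀ : (G.ι →₀ ℝ) →ₗ[ℝ] ℝ where
  toFun a := (weilMellin (fun t ↦ (G.rtest a t : ℂ)) 0).re
  map_add' a b := by
    have ha := G.isWeilTest_rtest a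
    have hb := G.isWeilTest_rtest b
    rw [rtest_add_coe, weilMellin_add ha.1.continuous ha.2 hb.1.continuous hb.2, Complex.add_re]
  map_smul' r a := by
    rw [rtest_smul_coe, weilMellin_const_mul, RingHom.id_apply, smul_eq_mul, Complex.re_ofReal_mul]

/-- `M₁ a = Re (rtest a)^(1) = ∫ toMul (rtest a) du` as an `ℝ`-linear map. -/
def M₁ : (G.ι →₀ ℝ) →ₗ[ℝ] ℝ where
  toFun a := (weilMellin (fun t ↦ (G.rtest a t : ℂ)) 1).re
  map_add' a b := by
    have ha := G.isWeilTest_rtest a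
    have hb := G.isWeilTest_rtest b
    rw [rtest_add_coe, weilMellin_add ha.1.continuous ha.2 hb.1.continuous hb.2, Complex.add_re]
  map_smul' r a := by
    rw [rtest_smul_coe, weilMellin_const_mul, RingHom.id_apply, smul_eq_mul, Complex.re_ofReal_mul]

/-- `M₀ a = ∫ toMul (rtest a) d*u` (`massDstar`). -/
theorem M₀_eq_massDstar (a : G.ι →₀ ℝ) : G.M₀ a = massDstar (toMul (G.rtest a)) := by
  change (weilMellin (fun t ↦ (G.rtest a t : ℂ)) 0).re = _
  rw [weilMellin_zero_eq_massDstar, Complex.ofReal_re]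

/-- `M₁ a = ∫ toMul (rtest a) du` (`massDu`). -/
theorem M₁_eq_massDu (a : G.ι →₀ ℝ) : G.M₁ a = massDu (toMul (G.rtest a)) := by
  change (weilMellin (fun t ↦ (G.rtest a t : ℂ)) 1).re = _
  rw [weilMellin_one_eq_massDu, Complex.ofReal_re]

/-! ## Weil's cross functional as a bilinear map -/

/-- `Wc a b = Re W(rtest a ⋆ (rtest b)~)` as an `ℝ`-bilinear map (bilinearity of `⋆`, additivity of
`~` and of `W` on test kernels — all in the tree). -/
def Wc : (G.ι →₀ ℝ) →ₗ[ℝ] (G.ι →₀ ℝ) →ₗ[ℝ] ℝ :=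
  LinearMap.mk₂ ℝ
    (fun a b ↦ (weilFunctional (weilConv (fun t ↦ (G.rtest a t : ℂ))
      (weilReflect fun t ↦ (G.rtest b t : ℂ)))).re)
    (fun a a' b ↦ by
      have ha := G.isWeilTest_rtest a
      have ha' := G.isWeilTest_rtest a'
      have hb := (G.isWeilTest_rtest b).weilReflect
      rw [rtest_add_coe, weilConv_add_left ha ha' hb,
        weilFunctional_add (ha.weilConv hb) (ha'.weilConv hb), Complex.add_re])
    (fun r a b ↦ by
      rw [rtest_smul_coe, weilConv_const_mul_left, weilFunctional_const_mul, smul_eq_mul,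
        Complex.re_ofReal_mul])
    (fun a b b' ↦ by
      have ha := G.isWeilTest_rtest a
      have hb := (G.isWeilTest_rtest b).weilReflect
      have hb' := (G.isWeilTest_rtest b').weilReflect
      rw [rtest_add_coe, weilReflect_add, weilConv_add_right ha hb hb',
        weilFunctional_add (ha.weilConv hb) (ha.weilConv hb'), Complex.add_re])
    (fun r a b ↦ by
      rw [rtest_smul_coe, weilReflect_const_mul, Complex.conj_ofReal, weilConv_const_mul_right,
        weilFunctional_const_mul, smul_eq_mul, Complex.re_ofReal_mul])

/-- Unfolding `Wc`. -/
theorem Wc_apply (a b : G.ι →₀ ℝ) :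
    G.Wc a b = (weilFunctional (weilConv (fun t ↦ (G.rtest a t : ℂ))
      (weilReflect fun t ↦ (G.rtest b t : ℂ)))).re := rfl

/-- `Wc` is symmetric (`W` is even; real test functions). -/
theorem Wc_comm (a b : G.ι →₀ ℝ) : G.Wc a b = G.Wc b a := by
  rw [Wc_apply, Wc_apply, weilFunctional_weilConv_weilReflect_swap_of_real
    (u := fun t ↦ (G.rtest b t : ℂ)) (v := fun t ↦ (G.rtest a t : ℂ))
    (fun t ↦ Complex.conj_ofReal _) (fun t ↦ Complex.conj_ofReal _)]

/-- The diagonal of `Wc` is Weil's quadratic functional `Re Q`. -/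
theorem Wc_self (a : G.ι →₀ ℝ) : G.Wc a a = (weilQuadratic fun t ↦ (G.rtest a t : ℂ)).re := rfl

/-! ## The prime-side form `2𝔰`, polarised -/

/-- **The prime-side form** `B(a, b) = M₀ a · M₁ b + M₁ a · M₀ b − Wc a b`: the symmetric bilinear
polarisation of `a ↦ 2 𝔰(f_a, f_a)` (`primeForm_self`). -/
def primeForm : LinearMap.BilinForm ℝ (G.ι →₀ ℝ) :=
  (LinearMap.mul ℝ ℝ).compl₁₂ G.M₀ G.M₁ + (LinearMap.mul ℝ ℝ).compl₁₂ G.M₁ G.M₀ - G.Wc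

/-- Unfolding `primeForm`. -/
@[simp] theorem primeForm_apply (a b : G.ι →₀ ℝ) :
    G.primeForm a b = G.M₀ a * G.M₁ b + G.M₁ a * G.M₀ b - G.Wc a b := by
  simp [primeForm]

/-- `primeForm` is symmetric. -/
theorem primeForm_comm (a b : G.ι →₀ ℝ) : G.primeForm a b = G.primeForm b a := by
  rw [primeForm_apply, primeForm_apply, G.Wc_comm a b]
  ring

/-- **The diagonal of the prime-side form is `2 𝔰(f, f) = 2 N(f ⋆ f̃)`** (`f = toMul (rtest a)`;
`two_mul_ccPairing_sub_two_mul_masses_eq`). -/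
theorem primeForm_self (a : G.ι →₀ ℝ) :
    G.primeForm a a = 2 * ccPairing (toMul (G.rtest a)) (toMul (G.rtest a)) := by
  have h := two_mul_ccPairing_sub_two_mul_masses_eq (G.isWeilTest_rtest a)
  rw [primeForm_apply, M₀_eq_massDstar, M₁_eq_massDu, Wc_self]
  linarith

/-! ## The carrier form on `(G.ι →₀ ℝ) × ℝ × ℝ` -/

/-- **The carrier form** (AXIOM-CONTENT §2): on `(a, x, y), (b, x', y')`,
`primeForm a b + x·M₀ b + x'·M₀ a + y·M₁ b + y'·M₁ a + x y' + x' y`. -/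
def carrierForm : LinearMap.BilinForm ℝ ((G.ι →₀ ℝ) × ℝ × ℝ) :=
  LinearMap.mk₂ ℝ
    (fun z w ↦ G.primeForm z.1 w.1 + z.2.1 * G.M₀ w.1 + w.2.1 * G.M₀ z.1 + z.2.2 * G.M₁ w.1 +
      w.2.2 * G.M₁ z.1 + z.2.1 * w.2.2 + w.2.1 * z.2.2)
    (fun z z' w ↦ by
      simp only [Prod.fst_add, Prod.snd_add, map_add, LinearMap.add_apply]; ring)
    (fun r z w ↦ by
      simp only [Prod.smul_fst, Prod.smul_snd, map_smul, LinearMap.smul_apply, smul_eq_mul]; ring)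
    (fun z w w' ↦ by
      simp only [Prod.fst_add, Prod.snd_add, map_add]; ring)
    (fun r z w ↦ by
      simp only [Prod.smul_fst, Prod.smul_snd, map_smul, smul_eq_mul]; ring)

/-- Unfolding `carrierForm`. -/
theorem carrierForm_apply (z w : (G.ι →₀ ℝ) × ℝ × ℝ) :
    G.carrierForm z w = G.primeForm z.1 w.1 + z.2.1 * G.M₀ w.1 + w.2.1 * G.M₀ z.1 +
      z.2.2 * G.M₁ w.1 + w.2.2 * G.M₁ z.1 + z.2.1 * w.2.2 + w.2.1 * z.2.2 := rfl

/-- The carrier form is symmetric. -/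
theorem carrierForm_comm (z w : (G.ι →₀ ℝ) × ℝ × ℝ) : G.carrierForm z w = G.carrierForm w z := by
  rw [carrierForm_apply, carrierForm_apply, G.primeForm_comm z.1 w.1]
  ring

/-- The first ruling `E₁ = (0, 1, 0)` of the carrier. -/
def carrierE₁ : (G.ι →₀ ℝ) × ℝ × ℝ := (0, 1, 0)

/-- The second ruling `E₂ = (0, 0, 1)` of the carrier. -/
def carrierE₂ : (G.ι →₀ ℝ) × ℝ × ℝ := (0, 0, 1)

/-- `z·E₁ = M₀ z.1 + z.2.2` (degree `∫ f d*u` plus the `e₂`-coordinate). -/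
@[simp] theorem carrierForm_E₁ (z : (G.ι →₀ ℝ) × ℝ × ℝ) :
    G.carrierForm z G.carrierE₁ = G.M₀ z.1 + z.2.2 := by
  simp [carrierForm_apply, carrierE₁]

/-- `z·E₂ = M₁ z.1 + z.2.1`. -/
@[simp] theorem carrierForm_E₂ (z : (G.ι →₀ ℝ) × ℝ × ℝ) :
    G.carrierForm z G.carrierE₂ = G.M₁ z.1 + z.2.1 := by
  simp [carrierForm_apply, carrierE₂]

/-- `E₁² = 0`. -/
theorem carrierForm_E₁_E₁ : G.carrierForm G.carrierE₁ G.carrierE₁ = 0 := by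
  simp [carrierE₁, carrierForm_apply]

/-- `E₂² = 0`. -/
theorem carrierForm_E₂_E₂ : G.carrierForm G.carrierE₂ G.carrierE₂ = 0 := by
  simp [carrierE₂, carrierForm_apply]

/-- `E₁·E₂ = 1`. -/
theorem carrierForm_E₁_E₂ : G.carrierForm G.carrierE₁ G.carrierE₂ = 1 := by
  simp [carrierE₁, carrierE₂, carrierForm_apply]

/-- The square of a class: `z·z = 2 M₀ M₁ − Re Q(rtest z.1) + 2 x M₀ + 2 y M₁ + 2 x y`. -/
theorem carrierForm_self (z : (G.ι →₀ ℝ) × ℝ × ℝ) :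
    G.carrierForm z z = 2 * (G.M₀ z.1 * G.M₁ z.1) - (weilQuadratic fun t ↦ (G.rtest z.1 t : ℂ)).re +
      2 * (z.2.1 * G.M₀ z.1) + 2 * (z.2.2 * G.M₁ z.1) + 2 * (z.2.1 * z.2.2) := by
  rw [carrierForm_apply, primeForm_apply, Wc_self]
  ring

/-- **KEY IDENTITY**: on `⟨E₁, E₂⟩^⊥` the carrier form IS minus Weil's functional,
`z·z = −Re Q(rtest z.1)` (the `x, y`-coordinates are forced to be `−M₁`, `−M₀`). -/
theorem carrierForm_self_of_perp {z : (G.ι →₀ ℝ) × ℝ × ℝ} (h₁ : G.carrierForm z G.carrierE₁ = 0)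
    (h₂ : G.carrierForm z G.carrierE₂ = 0) :
    G.carrierForm z z = -(weilQuadratic fun t ↦ (G.rtest z.1 t : ℂ)).re := by
  rw [carrierForm_E₁] at h₁
  rw [carrierForm_E₂] at h₂
  have hy : z.2.2 = -G.M₀ z.1 := by linarith
  have hx : z.2.1 = -G.M₁ z.1 := by linarith
  rw [carrierForm_self, hx, hy]
  ring

/-- The diagonal class `(a, 0, 0)` has square `2 𝔰(f_a, f_a)` and degrees `M₀ a`, `M₁ a`. -/
theorem carrierForm_inl_self (a : G.ι →₀ ℝ) :
    G.carrierForm (a, 0, 0) (a, 0, 0) = 2 * ccPairing (toMul (G.rtest a)) (toMul (G.rtest a)) := by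
  rw [carrierForm_apply, primeForm_self]
  simp

end GeneratingFamily

end Summit.RiemannHypothesis.RiemannHypothesis.Theorems.MotivicDoor.AWS
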